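import Summits.NavierStokesRegularity.NavierStokesRegularity.Theorems.WakeRatchetEternalViscousRateCircuitPumpShellZeroIdentity
import Summits.NavierStokesRegularity.NavierStokesRegularity.Theorems.WakeRatchetEternalViscousRate.Negative.EternalViscousRateFalseOfFineFixedSeedTodaPumps

/-!
# `WakeRatchet.EternalViscousRate` (stmt-NavierStokesRegularity-25647) — the seed-free AMPLITUDE FLOOR of fixed-seed Toda pumps
# (a-priori bound for the construction item `FineFixedSeedTodaPumps` of the Negative file p829025; part 2 of 2)

Every exactly self-similar (period 1), Type-I, non-trivial solution `X = (a, b)` on `(-∞, 0)` of the m = 2 seeded graded Toda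
circuit `T_ε` (ANY real seed `ε`) at scale ratio `lam > 1` has a LARGE CARRIER:

  `sup_{t<0} a_0(t) ≥ 1/(q − q⁻¹) = lam^{1/5}/(lam^{2/5} − 1) ≥ 5/(2(lam − 1))`,  `q = lam^{1/5}`

(`todaPump_carrier_floor`, `todaPump_carrier_floor_explicit`; by self-similarity the same holds at shell `n` with the factor
`lam^{-n/5}`).  PROOF: let `τ ↑ 0` in the integrated shell-0 identity of the companion file `…CircuitPumpShellZeroIdentity`
(`E(τ) ≥ 0`): `∫_{<0} (a_0² + b_0²) ≤ (q − q⁻¹) ∫_{<0} a_0(rs) b_0(s)² ds` (`shellZero_action_le_flux`) `≤ (q − q⁻¹)·sup a_0·∫_{<0} b_0²`;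
if `sup a_0 · (q − q⁻¹) < 1` this forces `a_0 = b_0 = 0` on `(-∞,0)` (a continuous non-negative function with zero integral on
an open set), and self-similarity (`dss_one`, `dss_down`) kills every shell, contradicting non-triviality.

WHY IT MATTERS (repair census of ⟨25647⟩, door (B) of the HAND10/HAND11 census).  `FineFixedSeedTodaPumps` asks for pumps of ONE
table `T_ε` at `lam ↓ 1`; the floor says their carriers blow up like `5/(2(lam−1))` whatever the seed, while the tree's only
existence engine (`PerpetualPumpCircuitPump.stub_clockBox` via `toda_clockBox_eps`) lives in the window `A₂² ε^{3/20} ≤ 1/2` (HS3),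
i.e. carriers `≤ 0.71 ε^{-3/40}`: at fixed seed that engine cannot reach `lam − 1 < 3.5 ε^{3/40}`, and below `lam − 1 ≍ √ε` every
pump has `A√ε ≫ 1` (the seed term dominates the Toda clock) — the «large-amplitude rewrite of toda_boot/into/cover» is not a rewrite
but a different regime, the scale-free seeded Toda front (cell numerics, evidence HAND12 on ⟨25647⟩: that front sheds a wake fraction
`≈ ε^{1.75}` per shell, against the DSS loss budget `1 − lam^{-2/5} ≈ (2/5)(lam−1)`).  Nothing here decides `FineFixedSeedTodaPumps`.
HONEST FRAMING: MODEL lattice ODEs only (Tao 2016 §4 circuits); nothing here is a statement about the Navier–Stokes equations; no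
registered stub of skeleton 842b1374 is closed; the crux ⟨25647⟩ and every summit statement remain OPEN.
-/

set_option linter.dupNamespace false

noncomputable section

open scoped BigOperators
open Set Real Filter Topology MeasureTheory

namespace Summit.NavierStokesRegularity.NavierStokesRegularity.Theorems.WakeRatchetCircuitPumpFloor

open Summit.NavierStokesRegularity.NavierStokesRegularity.Theorems.CircuitPumpNegative
open Summit.NavierStokesRegularity.NavierStokesRegularity.Theorems.PerpetualPumpCircuitPump
open Summit.NavierStokesRegularity.NavierStokesRegularity.Theorems.WakeRatchetCircuitPumpClock

/-! ## The action–flux inequality (`τ ↑ 0` in the integrated identity) -/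

/-- **Action–flux inequality.**  For a period-1 self-similar Type-I solution of `T_ε`:
`∫_{<0} (a_0² + b_0²) ≤ (q − q⁻¹) ∫_{<0} a_0(lam^{4/5}s) b_0(s)² ds`, `q = lam^{1/5}` — the whole time-integrated energy of
shell `0` is paid for by the excess of the DSS-rescaled inflow over the outflow. -/
theorem shellZero_action_le_flux {lam ε : ℝ} (hlam : 1 < lam) (X : Fin 2 → ℤ → ℝ → ℝ)
    (hode : SolvesODE lam (fun (i₁ i₂ i₃ : Fin 2) (μ : Option (Fin 3)) => if μ = none then (if i₁ = 1 ∧ i₂ = 1 ∧ i₃ = 0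
                then (-1 : ℝ) else if i₁ = 1 ∧ i₂ = 0 ∧ i₃ = 1 then 1 / 2 else if i₁ = 0 ∧ i₂ = 1 ∧ i₃ = 1
                then 1 / 2 else if i₁ = 0 ∧ i₂ = 0 ∧ i₃ = 1 then ε else if i₁ = 0 ∧ i₂ = 1 ∧ i₃ = 0 then -ε /
                2 else if i₁ = 1 ∧ i₂ = 0 ∧ i₃ = 0 then -ε / 2 else 0) else if μ = some 2 then (if i₁ = 1 ∧
                i₂ = 1 ∧ i₃ = 0 then 1 else 0) else if μ = some 1 then (if i₁ = 1 ∧ i₂ = 0 ∧ i₃ = 1 then -1 /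
                2 else 0) else (if i₁ = 0 ∧ i₂ = 1 ∧ i₃ = 1 then -1 / 2 else 0)) X)
    (hdss : IsDSS lam 1 X) (hTI : IsTypeI lam X) :
    IntegrableOn (fun s => X 0 0 s ^ 2 + X 1 0 s ^ 2) (Iio 0) ∧
    IntegrableOn (fun s => X 0 0 (lam ^ (4 / 5 : ℝ) * s) * X 1 0 s ^ 2) (Iio 0) ∧
    ∫ s in Iio 0, (X 0 0 s ^ 2 + X 1 0 s ^ 2) ≤
      (lam ^ (1 / 5 : ℝ) - lam ^ (-(1 / 5 : ℝ))) * ∫ s in Iio 0, X 0 0 (lam ^ (4 / 5 : ℝ) * s) * X 1 0 s ^ 2 := by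
  have hpos : 0 < lam := by linarith
  obtain ⟨hEi, hhi, hid⟩ := shellZero_energy_identity hlam X hode hdss hTI
  refine ⟨hEi, hhi, ?_⟩
  set q : ℝ := lam ^ (1 / 5 : ℝ) with hq
  set r : ℝ := lam ^ (4 / 5 : ℝ) with hr
  have hr0 : 0 < r := Real.rpow_pos_of_pos hpos _
  have hrinv : lam ^ (-(4 / 5 : ℝ)) = r⁻¹ := by rw [hr, Real.rpow_neg hpos.le]
  set E : ℝ → ℝ := fun s => X 0 0 s ^ 2 + X 1 0 s ^ 2 with hE
  set h : ℝ → ℝ := fun s => X 0 0 (r * s) * X 1 0 s ^ 2 with hh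
  -- the three sequences of half-line integrals converge to the integrals over `(-∞,0)`
  have hτ : ∀ n : ℕ, -(1 / ((n : ℝ) + 1)) < 0 := fun n => by
    have : (0 : ℝ) < 1 / ((n : ℝ) + 1) := by positivity
    linarith
  have h1 : Tendsto (fun n : ℕ => ∫ s in Iic (-(1 / ((n : ℝ) + 1))), E s) atTop (𝓝 (∫ s in Iio 0, E s)) :=
    tendsto_integral_Iic_neg_div hEi 1 one_pos
  have h2 : Tendsto (fun n : ℕ => ∫ s in Iic (-(1 / ((n : ℝ) + 1))), h s) atTop (𝓝 (∫ s in Iio 0, h s)) :=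
    tendsto_integral_Iic_neg_div hhi 1 one_pos
  have h3 : Tendsto (fun n : ℕ => ∫ s in Iic (-(r⁻¹ / ((n : ℝ) + 1))), h s) atTop (𝓝 (∫ s in Iio 0, h s)) :=
    tendsto_integral_Iic_neg_div hhi r⁻¹ (inv_pos.2 hr0)
  -- E(τ_n) expressed through them
  have hEτ : ∀ n : ℕ, E (-(1 / ((n : ℝ) + 1))) =
      2 * q * (∫ s in Iic (-(r⁻¹ / ((n : ℝ) + 1))), h s) - 2 * q⁻¹ * (∫ s in Iic (-(1 / ((n : ℝ) + 1))), h s)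
        - 2 * ∫ s in Iic (-(1 / ((n : ℝ) + 1))), E s := by
    intro n
    have hidn := hid _ (hτ n)
    rw [hrinv, Real.rpow_neg hpos.le] at hidn
    have e : r⁻¹ * -(1 / ((n : ℝ) + 1)) = -(r⁻¹ / ((n : ℝ) + 1)) := by ring
    rw [e] at hidn
    simp only [hE, hh]
    rw [← hq] at hidn
    linarith
  have hlim : Tendsto (fun n : ℕ => E (-(1 / ((n : ℝ) + 1)))) atTop
      (𝓝 (2 * q * (∫ s in Iio 0, h s) - 2 * q⁻¹ * (∫ s in Iio 0, h s) - 2 * ∫ s in Iio 0, E s)) := by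
    have := ((h3.const_mul (2 * q)).sub (h2.const_mul (2 * q⁻¹))).sub (h1.const_mul 2)
    refine this.congr fun n => ?_
    rw [hEτ n]
  have hnn : 0 ≤ 2 * q * (∫ s in Iio 0, h s) - 2 * q⁻¹ * (∫ s in Iio 0, h s) - 2 * ∫ s in Iio 0, E s :=
    ge_of_tendsto' hlim fun n => by positivity
  rw [Real.rpow_neg hpos.le, ← hq]
  simp only [hE, hh] at hnn ⊢
  nlinarith [hnn]

/-! ## The amplitude floor -/

/-- **AMPLITUDE FLOOR (seed-free).**  Let `X = (a, b)` solve the seeded graded Toda circuit `T_ε` on `(-∞,0)` (ANY real seed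
`ε`) at scale ratio `lam > 1`, exactly self-similar with period 1, Type I and non-trivial.  Then for every `B` with
`B · (lam^{1/5} − lam^{−1/5}) < 1` the carrier of shell `0` exceeds `B` at some negative time:
`sup_{t<0} a_0(t) ≥ 1/(q − q⁻¹) = lam^{1/5}/(lam^{2/5} − 1)`.  (By self-similarity the same holds at every shell `n` with the
factor `lam^{-n/5}`.)  In particular the carriers of any fixed-seed family of pumps with `lam ↓ 1` (the object of
`WakeRatchetCircuitPumpNoUniform.FineFixedSeedTodaPumps`) are unbounded. -/
theorem todaPump_carrier_floor {lam ε : ℝ} (hlam : 1 < lam) (X : Fin 2 → ℤ → ℝ → ℝ)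
    (hode : SolvesODE lam (fun (i₁ i₂ i₃ : Fin 2) (μ : Option (Fin 3)) => if μ = none then (if i₁ = 1 ∧ i₂ = 1 ∧ i₃ = 0
                then (-1 : ℝ) else if i₁ = 1 ∧ i₂ = 0 ∧ i₃ = 1 then 1 / 2 else if i₁ = 0 ∧ i₂ = 1 ∧ i₃ = 1
                then 1 / 2 else if i₁ = 0 ∧ i₂ = 0 ∧ i₃ = 1 then ε else if i₁ = 0 ∧ i₂ = 1 ∧ i₃ = 0 then -ε /
                2 else if i₁ = 1 ∧ i₂ = 0 ∧ i₃ = 0 then -ε / 2 else 0) else if μ = some 2 then (if i₁ = 1 ∧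
                i₂ = 1 ∧ i₃ = 0 then 1 else 0) else if μ = some 1 then (if i₁ = 1 ∧ i₂ = 0 ∧ i₃ = 1 then -1 /
                2 else 0) else (if i₁ = 0 ∧ i₂ = 1 ∧ i₃ = 1 then -1 / 2 else 0)) X)
    (hdss : IsDSS lam 1 X) (hTI : IsTypeI lam X) (hnt : IsNontrivial X)
    {B : ℝ} (hB : B * (lam ^ (1 / 5 : ℝ) - lam ^ (-(1 / 5 : ℝ))) < 1) :
    ∃ t : ℝ, t < 0 ∧ B < X 0 0 t := by
  have hpos : 0 < lam := by linarith
  by_contra hcon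
  push Not at hcon
  -- hcon : ∀ t < 0, X 0 0 t ≤ B
  obtain ⟨hEi, hhi, hineq⟩ := shellZero_action_le_flux hlam X hode hdss hTI
  set q : ℝ := lam ^ (1 / 5 : ℝ) with hq
  set r : ℝ := lam ^ (4 / 5 : ℝ) with hr
  have hq1 : 1 < q := Real.one_lt_rpow hlam (by norm_num)
  have hr0 : 0 < r := Real.rpow_pos_of_pos hpos _
  have hqq : 0 < q - lam ^ (-(1 / 5 : ℝ)) := by
    rw [Real.rpow_neg hpos.le, ← hq]
    have : q⁻¹ < 1 := inv_lt_one_of_one_lt₀ hq1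
    linarith
  set E : ℝ → ℝ := fun s => X 0 0 s ^ 2 + X 1 0 s ^ 2 with hE
  set h : ℝ → ℝ := fun s => X 0 0 (r * s) * X 1 0 s ^ 2 with hh
  set β : ℝ → ℝ := fun s => X 1 0 s ^ 2 with hβ
  -- β is integrable and sits between h/B and E
  have hca : ∀ i : Fin 2, ContinuousOn (fun s => X i 0 s) (Iio 0) := fun i s hs =>
    (hode i 0 s hs).continuousAt.continuousWithinAt
  have hβi : IntegrableOn β (Iio 0) := by
    refine Integrable.mono' hEi (((hca 1).pow 2).aestronglyMeasurable measurableSet_Iio) ?_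
    refine ae_restrict_of_forall_mem measurableSet_Iio fun t _ => ?_
    simp only [hβ, hE, Real.norm_eq_abs, abs_pow, sq_abs]
    nlinarith [sq_nonneg (X 0 0 t)]
  have hHle : ∫ s in Iio 0, h s ≤ B * ∫ s in Iio 0, β s := by
    rw [← integral_const_mul]
    refine setIntegral_mono_on hhi (hβi.const_mul B) measurableSet_Iio fun s hs => ?_
    simp only [hh, hβ]
    exact mul_le_mul_of_nonneg_right (hcon _ (mul_neg_of_pos_of_neg hr0 hs)) (sq_nonneg _)
  have hβE : ∫ s in Iio 0, β s ≤ ∫ s in Iio 0, E s :=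
    setIntegral_mono_on hβi hEi measurableSet_Iio fun s _ => by
      simp only [hβ, hE]; nlinarith [sq_nonneg (X 0 0 s)]
  have hβ0 : 0 ≤ ∫ s in Iio 0, β s := setIntegral_nonneg measurableSet_Iio fun s _ => sq_nonneg _
  have hD0 : 0 ≤ ∫ s in Iio 0, E s := setIntegral_nonneg measurableSet_Iio fun s _ => by positivity
  -- hence the total action of shell 0 vanishes
  have hD : ∫ s in Iio 0, E s = 0 := by
    have h1 : ∫ s in Iio 0, E s ≤ (q - lam ^ (-(1 / 5 : ℝ))) * (B * ∫ s in Iio 0, β s) :=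
      hineq.trans (mul_le_mul_of_nonneg_left hHle hqq.le)
    by_cases hB0 : 0 ≤ B
    · have h2 : (q - lam ^ (-(1 / 5 : ℝ))) * (B * ∫ s in Iio 0, β s) ≤
          (B * (q - lam ^ (-(1 / 5 : ℝ)))) * ∫ s in Iio 0, E s := by
        rw [← mul_assoc, mul_comm (q - _) B]
        exact mul_le_mul_of_nonneg_left hβE (mul_nonneg hB0 hqq.le)
      nlinarith
    · push Not at hB0
      have h2 : (q - lam ^ (-(1 / 5 : ℝ))) * (B * ∫ s in Iio 0, β s) ≤ 0 :=
        mul_nonpos_of_nonneg_of_nonpos hqq.le (mul_nonpos_of_nonpos_of_nonneg hB0.le hβ0)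
      linarith
  -- so E ≡ 0 on `(-∞,0)`: a continuous nonnegative function with zero integral on an open set
  have hEc : ContinuousOn E (Iio 0) := ((hca 0).pow 2).add ((hca 1).pow 2)
  have hEzero : ∀ t : ℝ, t < 0 → E t = 0 := by
    by_contra hne
    push Not at hne
    obtain ⟨t₀, ht₀, hEt₀⟩ := hne
    have hopen : IsOpen (Iio (0 : ℝ) ∩ E ⁻¹' {0}ᶜ) := hEc.isOpen_inter_preimage isOpen_Iio isOpen_compl_singleton
    have hmem : t₀ ∈ Iio (0 : ℝ) ∩ E ⁻¹' {0}ᶜ := ⟨ht₀, hEt₀⟩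
    have hμ : 0 < volume (Function.support E ∩ Iio 0) := by
      rw [Function.support_eq_preimage, inter_comm]
      exact hopen.measure_pos volume ⟨t₀, hmem⟩
    have hposint : 0 < ∫ s in Iio 0, E s := by
      refine (setIntegral_pos_iff_support_of_nonneg_ae ?_ hEi).2 hμ
      exact ae_restrict_of_forall_mem measurableSet_Iio fun s _ => by simp only [Pi.zero_apply, hE]; positivity
    linarith
  -- both shell-0 modes vanish
  have hX0 : ∀ (i : Fin 2) (t : ℝ), t < 0 → X i 0 t = 0 := by
    intro i t ht
    have h := hEzero t ht
    simp only [hE] at h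
    have h' := (add_eq_zero_iff_of_nonneg (sq_nonneg _) (sq_nonneg _)).1 h
    rcases fin_two_eq_zero_or_one i with rfl | rfl
    · exact pow_eq_zero_iff (n := 2) (by norm_num) |>.1 h'.1
    · exact pow_eq_zero_iff (n := 2) (by norm_num) |>.1 h'.2
  -- self-similarity: every shell vanishes
  have hup : ∀ (j : ℕ) (i : Fin 2) (t : ℝ), t < 0 → X i (j : ℤ) t = 0 := by
    intro j
    induction j with
    | zero => intro i t ht; exact_mod_cast hX0 i t ht
    | succ j ih =>
      intro i t ht
      have hrt : r * t < 0 := mul_neg_of_pos_of_neg hr0 ht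
      have hd := dss_one hdss i (j : ℤ) (r * t) hrt
      have e : lam ^ (-(4 / 5 : ℝ)) * (r * t) = t := by
        rw [hr, ← mul_assoc, ← Real.rpow_add hpos]; norm_num
      rw [e, ih i (r * t) hrt, mul_zero] at hd
      exact_mod_cast hd
  have hdown : ∀ (j : ℕ) (i : Fin 2) (t : ℝ), t < 0 → X i (-(j : ℤ)) t = 0 := by
    intro j
    induction j with
    | zero => intro i t ht; exact_mod_cast hX0 i t ht
    | succ j ih =>
      intro i t ht
      have hd := dss_down hlam hdss i (-(j : ℤ)) t ht
      have hrt : lam ^ (-((4 / 5 : ℝ) * ((1 : ℕ) : ℝ))) * t < 0 :=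
        mul_neg_of_pos_of_neg (Real.rpow_pos_of_pos hpos _) ht
      rw [ih i _ hrt, mul_zero] at hd
      have e : (-(j : ℤ) - ((1 : ℕ) : ℤ)) = -(((j + 1 : ℕ) : ℤ)) := by push_cast; ring
      rw [e] at hd
      exact hd
  obtain ⟨i, n, t, ht, hx⟩ := hnt
  obtain ⟨j, rfl | rfl⟩ := n.eq_nat_or_neg
  · exact hx (hup j i t ht)
  · exact hx (hdown j i t ht)

/-- **The floor with an explicit constant: `sup_{t<0} a_0(t) ≥ 5/(2(lam − 1))`.**  (`q − q⁻¹ ≤ (2/5)(lam − 1)` for `q = lam^{1/5}`,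
by Bernoulli.)  Fixed seed, `lam ↓ 1` ⇒ carrier amplitude `→ ∞` like `(lam−1)⁻¹`; compare the clock-box window of the tree's
existence engine, `A₂² ε^{3/20} ≤ 1/2` (`toda_clockBox_eps`, HS3). -/
theorem todaPump_carrier_floor_explicit {lam ε : ℝ} (hlam : 1 < lam) (X : Fin 2 → ℤ → ℝ → ℝ)
    (hode : SolvesODE lam (fun (i₁ i₂ i₃ : Fin 2) (μ : Option (Fin 3)) => if μ = none then (if i₁ = 1 ∧ i₂ = 1 ∧ i₃ = 0
                then (-1 : ℝ) else if i₁ = 1 ∧ i₂ = 0 ∧ i₃ = 1 then 1 / 2 else if i₁ = 0 ∧ i₂ = 1 ∧ i₃ = 1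
                then 1 / 2 else if i₁ = 0 ∧ i₂ = 0 ∧ i₃ = 1 then ε else if i₁ = 0 ∧ i₂ = 1 ∧ i₃ = 0 then -ε /
                2 else if i₁ = 1 ∧ i₂ = 0 ∧ i₃ = 0 then -ε / 2 else 0) else if μ = some 2 then (if i₁ = 1 ∧
                i₂ = 1 ∧ i₃ = 0 then 1 else 0) else if μ = some 1 then (if i₁ = 1 ∧ i₂ = 0 ∧ i₃ = 1 then -1 /
                2 else 0) else (if i₁ = 0 ∧ i₂ = 1 ∧ i₃ = 1 then -1 / 2 else 0)) X)
    (hdss : IsDSS lam 1 X) (hTI : IsTypeI lam X) (hnt : IsNontrivial X)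
    {B : ℝ} (hB : B < 5 / (2 * (lam - 1))) :
    ∃ t : ℝ, t < 0 ∧ B < X 0 0 t := by
  have hpos : 0 < lam := by linarith
  refine todaPump_carrier_floor hlam X hode hdss hTI hnt ?_
  -- `q − q⁻¹ ≤ (2/5)(lam−1)`
  set q : ℝ := lam ^ (1 / 5 : ℝ) with hq
  have hq1 : 1 < q := Real.one_lt_rpow hlam (by norm_num)
  have hq0 : 0 < q := by linarith
  have hqinv : lam ^ (-(1 / 5 : ℝ)) = q⁻¹ := by rw [hq, Real.rpow_neg hpos.le]
  have hqle : q ≤ 1 + (1 / 5 : ℝ) * (lam - 1) := by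
    have h := rpow_one_add_le_one_add_mul_self (s := lam - 1) (by linarith) (p := 1 / 5)
      (by norm_num) (by norm_num)
    rw [hq]
    convert h using 2
    ring
  set d : ℝ := (1 / 5 : ℝ) * (lam - 1) with hd
  have hd0 : 0 < d := by rw [hd]; linarith
  have hinv : 1 - d ≤ q⁻¹ := by
    have h1 : (1 + d)⁻¹ ≤ q⁻¹ := inv_anti₀ hq0 hqle
    have h2 : 1 - d ≤ (1 + d)⁻¹ := by
      rw [inv_eq_one_div, le_div_iff₀ (by linarith)]
      nlinarith
    exact h2.trans h1
  rw [hqinv]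
  have hgap : q - q⁻¹ ≤ 2 / 5 * (lam - 1) := by linarith
  by_cases hB0 : 0 ≤ B
  · have hl1 : 0 < lam - 1 := by linarith
    have h1 : B * (q - q⁻¹) ≤ B * (2 / 5 * (lam - 1)) := mul_le_mul_of_nonneg_left hgap hB0
    have h2 : B * (2 / 5 * (lam - 1)) < 1 := by
      rw [lt_div_iff₀ (by linarith)] at hB
      linarith
    linarith
  · push Not at hB0
    have : B * (q - q⁻¹) ≤ 0 := by
      have hqq : 0 ≤ q - q⁻¹ := by have := inv_lt_one_of_one_lt₀ hq1; linarith
      exact mul_nonpos_of_nonpos_of_nonneg hB0.le hqq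
    linarith

/-- **The construction item in its own vocabulary: fixed-seed fine pumps have UNBOUNDED carriers.**  If
`FineFixedSeedTodaPumps` holds (the open construction item of the Negative file p829025: one seed `ε ∈ (0,1]`, pumps of `T_ε` at
scale ratios `lam ↓ 1`), then for every level `A` some pump of that family has shell-0 carrier above `A` at some negative time —
the family leaves every bounded-amplitude regime, in particular the clock-box window `A₂²ε^{3/20} ≤ 1/2` of the tree's existence
engine.  Nothing here decides the item. -/
theorem fineFixedSeedTodaPumps_carriers_unbounded
    (H : WakeRatchetCircuitPumpNoUniform.FineFixedSeedTodaPumps) :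
    ∃ ε : ℝ, 0 < ε ∧ ε ≤ 1 ∧ ∀ A : ℝ, ∃ lam : ℝ, 1 < lam ∧ lam < 1 + 5 / (2 * (|A| + 1)) ∧
      ∃ X : Fin 2 → ℤ → ℝ → ℝ, SolvesODE lam (fun (i₁ i₂ i₃ : Fin 2) (μ : Option (Fin 3)) => if μ = none then (if i₁ = 1 ∧ i₂ = 1 ∧ i₃ = 0
                then (-1 : ℝ) else if i₁ = 1 ∧ i₂ = 0 ∧ i₃ = 1 then 1 / 2 else if i₁ = 0 ∧ i₂ = 1 ∧ i₃ = 1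
                then 1 / 2 else if i₁ = 0 ∧ i₂ = 0 ∧ i₃ = 1 then ε else if i₁ = 0 ∧ i₂ = 1 ∧ i₃ = 0 then -ε /
                2 else if i₁ = 1 ∧ i₂ = 0 ∧ i₃ = 0 then -ε / 2 else 0) else if μ = some 2 then (if i₁ = 1 ∧
                i₂ = 1 ∧ i₃ = 0 then 1 else 0) else if μ = some 1 then (if i₁ = 1 ∧ i₂ = 0 ∧ i₃ = 1 then -1 /
                2 else 0) else (if i₁ = 0 ∧ i₂ = 1 ∧ i₃ = 1 then -1 / 2 else 0)) X ∧ IsDSS lam 1 X ∧ IsTypeI lam X ∧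
        IsNontrivial X ∧ ∃ t : ℝ, t < 0 ∧ A < X 0 0 t := by
  obtain ⟨ε, hε, hε1, Hf⟩ := H
  refine ⟨ε, hε, hε1, fun A => ?_⟩
  have hA1 : 0 < |A| + 1 := by positivity
  obtain ⟨lam, hlam, hlt, X, hode, hdss, hTI, hnt⟩ := Hf (1 + 5 / (2 * (|A| + 1)))
    (by have : (0 : ℝ) < 5 / (2 * (|A| + 1)) := by positivity
        linarith)
  refine ⟨lam, hlam, hlt, X, hode, hdss, hTI, hnt, ?_⟩
  refine todaPump_carrier_floor_explicit hlam X hode hdss hTI hnt ?_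
  -- `A < 5/(2(lam−1))` because `lam − 1 < 5/(2(|A|+1))`
  have hl1 : 0 < lam - 1 := by linarith
  have h1 : lam - 1 < 5 / (2 * (|A| + 1)) := by linarith
  have h2 : (|A| + 1) < 5 / (2 * (lam - 1)) := by
    rw [lt_div_iff₀ (by linarith)]
    rw [lt_div_iff₀ (by positivity)] at h1
    nlinarith
  linarith [le_abs_self A]

end Summit.NavierStokesRegularity.NavierStokesRegularity.Theorems.WakeRatchetCircuitPumpFloor

end
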